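import Literature.NumberTheory.Sieve.CFSemigroupFrobenius
import Literature.NumberTheory.Sieve.CFSemigroupCriticalExponent
import HarnessLib

/-!
# The Frobenius-norm count for `Γ_A`: `#{γ ∈ Γ_A : ‖γ‖_F ≤ R} ~ c_A R^{2δ_A}`

Support file (all results proved) for the named fact
`Literature.NumberTheory.Sieve.MageeOhWinter2019_uniformCounting` (`CFSemigroupCounting.lean`).
This is the main term of [MageeOhWinter2019, Thm. 11] at level `q = 1` (`G ≡ 1`, `γ₀ = e`), i.e.
the asymptotic `cfCount A 1 1 R ~ c_A R^{2δ_A}` for the Frobenius-norm ball (Hensley/Lalley orbit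
counting for the continued fractions semigroup), WITHOUT the power saving (which needs Dolgopyat
bounds). Following [MageeOhWinter2019, §3, Lemmas 12–14] with a FIXED suffix length `N`: every even
word of length `≥ N` is `u v` with `|v| = N`; by the bridging lemma (`CFSemigroupFrobenius.lean`)
`‖M_u M_v‖²_F` is `d_u(x_v)² (1 + (M_u x_v)²) C_v` up to factors `e^{O(2^{-N})}`, so the count of such
words with suffix `v` is sandwiched between the even threshold counts
`N_even(R e^{∓c 2^{-N}}/√C_v, x_v; 𝟙, √(1+y²))` of `CFSemigroupRenewalEven.lean`, each `~ c_v X^{2δ}`.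
Letting `R → ∞` and then `N → ∞` (`limsup ≤ e^{O(2^{-N})} liminf`) gives the asymptotic.

* `cfΘ₀`: the threshold `Φ(y) = √(1 + y²)`;
* `cfCount_eq_tsum`: `cfCount A 1 1 R = Σ_n N_n^{norm}(R)` over even lengths (words ↔ elements);
* `cfSuffixCount` and its sandwich `cfEvenCountT … X₋ ≤ S_v ≤ cfEvenCountT … X₊`;
* `cfCount_one_tendsto`: **`cfCount A 1 1 R / R^{2δ_A} → c_A > 0`**. [cite: MageeOhWinter2019, Thm. 11]

## References

* M. Magee, H. Oh, D. Winter, J. reine angew. Math. 753 (2019) 89–135, Thm. 11, Lemmas 12–14,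
  Prop. 17. [MageeOhWinter2019]
* D. Hensley, J. Number Theory 40 (1992) 336–358 (counting for continued fraction Cantor sets).
-/

noncomputable section

open Set Filter Metric MeasureTheory
open scoped Topology MatrixGroups

namespace Literature.NumberTheory.Sieve

variable {A : Finset ℕ}

/-! ### The threshold `Φ(y) = √(1 + y²)` -/

/-- `|√(1+x²) - √(1+y²)| ≤ |x - y|`. [folklore] -/
theorem abs_sqrt_one_add_sq_sub_le (x y : ℝ) : |Real.sqrt (1 + x ^ 2) - Real.sqrt (1 + y ^ 2)| ≤ |x - y| := by
  set a := Real.sqrt (1 + x ^ 2) with ha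
  set b := Real.sqrt (1 + y ^ 2) with hb
  have ha0 : 0 < a := Real.sqrt_pos.2 (by positivity)
  have hb0 : 0 < b := Real.sqrt_pos.2 (by positivity)
  have hxa : |x| ≤ a := by
    rw [ha, ← Real.sqrt_sq_eq_abs]; exact Real.sqrt_le_sqrt (by nlinarith)
  have hyb : |y| ≤ b := by
    rw [hb, ← Real.sqrt_sq_eq_abs]; exact Real.sqrt_le_sqrt (by nlinarith)
  have hprod : (a - b) * (a + b) = x ^ 2 - y ^ 2 := by
    have h1 : a ^ 2 = 1 + x ^ 2 := Real.sq_sqrt (by positivity)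
    have h2 : b ^ 2 = 1 + y ^ 2 := Real.sq_sqrt (by positivity)
    nlinarith
  have hab : 0 < a + b := by linarith
  have key : |a - b| * (a + b) ≤ |x - y| * (a + b) := by
    calc |a - b| * (a + b) = |(a - b) * (a + b)| := by rw [abs_mul, abs_of_pos hab]
      _ = |x - y| * |x + y| := by rw [hprod, show x ^ 2 - y ^ 2 = (x - y) * (x + y) by ring, abs_mul]
      _ ≤ |x - y| * (a + b) := by
          refine mul_le_mul_of_nonneg_left ((abs_add_le _ _).trans (add_le_add hxa hyb)) (abs_nonneg _)
  exact le_of_mul_le_mul_right key hab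

/-- **The threshold `Φ(y) = √(1 + y²)`** (`Φ² = 1 + y²`, `Φ ≥ 1`, `1`-Lipschitz, `log Φ ≤ 1`).
[cite: MageeOhWinter2019, Lemma 12] -/
def cfΘ₀ : CfThreshold where
  Φ := fun y => Real.sqrt (1 + y ^ 2)
  L := 1
  Λ := 1
  L_nonneg := zero_le_one
  one_le := fun y _ => Real.one_le_sqrt.2 (by nlinarith)
  log_le := fun y hy => by
    have hpos : 0 < Real.sqrt (1 + y ^ 2) := Real.sqrt_pos.2 (by positivity)
    have h2 : Real.sqrt (1 + y ^ 2) ≤ 2 := by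
      have h : Real.sqrt (1 + y ^ 2) ≤ Real.sqrt (2 ^ 2) := Real.sqrt_le_sqrt (by nlinarith [hy.1, hy.2])
      rwa [Real.sqrt_sq (by norm_num : (0 : ℝ) ≤ 2)] at h
    linarith [Real.log_le_sub_one_of_pos hpos]
  lip := fun x _ y _ => by rw [one_mul]; exact abs_sqrt_one_add_sq_sub_le x y

/-- `Φ(y)² = 1 + y²`. [folklore] -/
theorem cfΘ₀_sq (y : ℝ) : cfΘ₀.Φ y ^ 2 = 1 + y ^ 2 := Real.sq_sqrt (by positivity)

/-- `Φ ≥ 0`. [folklore] -/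
theorem cfΘ₀_nonneg (y : ℝ) : 0 ≤ cfΘ₀.Φ y := Real.sqrt_nonneg _

/-! ### The Frobenius norm squared of an integer matrix -/

/-- `‖M‖²_F = Σᵢⱼ Mᵢⱼ²`. [cite: MageeOhWinter2019, §1] -/
def cfNormSq (M : Matrix (Fin 2) (Fin 2) ℤ) : ℝ := ∑ i, ∑ j, ((M i j : ℤ) : ℝ) ^ 2

/-- `q² = M₁₁² ≤ ‖M‖²`. [folklore] -/
theorem sq_apply_11_le_cfNormSq (M : Matrix (Fin 2) (Fin 2) ℤ) : ((M 1 1 : ℤ) : ℝ) ^ 2 ≤ cfNormSq M := by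
  simp only [cfNormSq, Fin.sum_univ_two]
  nlinarith [sq_nonneg ((M 0 0 : ℤ) : ℝ), sq_nonneg ((M 0 1 : ℤ) : ℝ), sq_nonneg ((M 1 0 : ℤ) : ℝ)]

/-- `2^{n-1} ≤ ‖M_w‖²` for a word of length `n` with digits `≥ 1`. [folklore] -/
theorem pow_le_cfNormSq_cfMat (hA : ∀ a ∈ A, 1 ≤ a) {n : ℕ} (w : Fin n → A) :
    (2 : ℝ) ^ (n - 1) ≤ cfNormSq (cfMat fun i => ((w i : A) : ℕ)) := by
  have h := pow_le_cfQ_sq (one_le_coe_digit hA w)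
  rw [cfQ_eq] at h
  have h' : (2 : ℝ) ^ (n - 1) ≤ ((cfMat (fun i => ((w i : A) : ℕ)) 1 1 : ℤ) : ℝ) ^ 2 := by exact_mod_cast h
  exact h'.trans (sq_apply_11_le_cfNormSq _)

/-- Words with `‖M_w‖² ≤ R² < 2^K` have length `≤ K`. [folklore] -/
theorem length_le_of_cfNormSq_le (hA : ∀ a ∈ A, 1 ≤ a) {n K : ℕ} (w : Fin n → A) {R : ℝ}
    (hK : R ^ 2 < (2 : ℝ) ^ K) (hw : cfNormSq (cfMat fun i => ((w i : A) : ℕ)) ≤ R ^ 2) : n ≤ K := by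
  by_contra h
  push Not at h
  have h1 := pow_le_cfNormSq_cfMat hA w
  have h2 : (2 : ℝ) ^ K ≤ (2 : ℝ) ^ (n - 1) := pow_le_pow_right₀ (by norm_num) (by omega)
  linarith

/-- `‖M_{uv}‖² = ‖M_u M_v‖²` (`M_{uv} = M_u M_v`). [folklore] -/
theorem cfNormSq_cfMat_append {m n : ℕ} (u : Fin m → A) (v : Fin n → A) :
    cfNormSq (cfMat fun i => ((Fin.append u v i : A) : ℕ)) =
      cfNormSq (cfMat (fun i => ((u i : A) : ℕ)) * cfMat (fun i => ((v i : A) : ℕ))) := by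
  rw [coe_append, cfMat_append]

/-! ### The per-suffix sandwich (bridging) -/

section Sandwich

variable (hA : ∀ a ∈ A, 1 ≤ a)
include hA

/-- The uniform proximity bound `η̄_N = 2^{1-N}`. [folklore] -/
def cfEtaBar (N : ℕ) : ℝ := (1 / 2 : ℝ) ^ (N - 1)

omit hA in
/-- `η̄_N ≥ 0`. [folklore] -/
theorem cfEtaBar_nonneg (N : ℕ) : 0 ≤ cfEtaBar N := by unfold cfEtaBar; positivity

/-- **The bridging sandwich for indicators:** for `η̄_N ≤ 1/16` and `R ≥ 0`, with `x = M_v 0`,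
`C = |d_v(i)|²`, `d = d_u(x)`, `y = M_u x`, `Φ(y) = √(1+y²)`:
`d Φ(y) ≤ R e^{-5η̄}/√C ⇒ ‖M_u M_v‖² ≤ R²` and `‖M_u M_v‖² ≤ R² ⇒ d Φ(y) ≤ R e^{8η̄}/√C`.
[cite: MageeOhWinter2019, Lemma 13] -/
theorem threshold_sandwich {n N : ℕ} (hN : cfEtaBar N ≤ 1 / 16) (u : Fin n → A) (v : Fin N → A) {R : ℝ}
    (hR : 0 ≤ R) :
    let Mu := cfMat fun i => ((u i : A) : ℕ)
    let Mv := cfMat fun i => ((v i : A) : ℕ)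
    let x := cfMoeb Mv 0
    let C := ‖cfDenC Mv Complex.I‖ ^ 2
    (cfDenom Mu x * cfΘ₀.Φ (cfMoeb Mu x) ≤ R * Real.exp (-(5 * cfEtaBar N)) / Real.sqrt C →
        cfNormSq (Mu * Mv) ≤ R ^ 2) ∧
      (cfNormSq (Mu * Mv) ≤ R ^ 2 →
        cfDenom Mu x * cfΘ₀.Φ (cfMoeb Mu x) ≤ R * Real.exp (8 * cfEtaBar N) / Real.sqrt C) := by
  intro Mu Mv x C
  have hηv := norm_cfMoebC_I_sub_le_geom hA v
  have hη : ‖cfMoebC Mv Complex.I - (x : ℂ)‖ ≤ cfEtaBar N := hηv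
  have hη16 : ‖cfMoebC Mv Complex.I - (cfMoeb (cfMat fun i => ((v i : A) : ℕ)) 0 : ℂ)‖ ≤ 1 / 16 := hη.trans hN
  obtain ⟨hlo, hup⟩ := normSq_mul_bounds hA u v hη16
  set η := ‖cfMoebC Mv Complex.I - (x : ℂ)‖ with hηdef
  have hη0 : 0 ≤ η := norm_nonneg _
  have hC1 : 1 ≤ C := one_le_normSq_cfDenC hA v
  have hC0 : 0 < C := by linarith
  have hsC : 0 < Real.sqrt C := Real.sqrt_pos.2 hC0
  have hsC2 : Real.sqrt C ^ 2 = C := Real.sq_sqrt hC0.le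
  set d := cfDenom Mu x with hddef
  set y := cfMoeb Mu x with hydef
  have hx : x ∈ Icc (0 : ℝ) 1 := cfMoeb_cfMat_mem (one_le_coe_digit hA v) ⟨le_rfl, zero_le_one⟩
  have hdpos : 0 < d := cfDenom_cfMat_pos (one_le_coe_digit hA u) hx
  have hΦ0 := cfΘ₀_nonneg y
  have hmain : cfDenom Mu x ^ 2 * (1 + cfMoeb Mu x ^ 2) * ‖cfDenC Mv Complex.I‖ ^ 2 = (d * cfΘ₀.Φ y) ^ 2 * C := by
    rw [mul_pow, cfΘ₀_sq]
  have hnorm : cfNormSq (Mu * Mv) = ∑ i, ∑ j, (((Mu * Mv) i j : ℤ) : ℝ) ^ 2 := rfl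
  rw [hmain] at hlo hup
  rw [hnorm]
  constructor
  · intro h
    -- `(dΦ)² C ≤ R² e^{-10η̄}` and `e^{9η} ≤ e^{10η̄}`
    have h1 : d * cfΘ₀.Φ y * Real.sqrt C ≤ R * Real.exp (-(5 * cfEtaBar N)) := by
      rwa [le_div_iff₀ hsC] at h
    have h2 : (d * cfΘ₀.Φ y) ^ 2 * C ≤ (R * Real.exp (-(5 * cfEtaBar N))) ^ 2 := by
      rw [← hsC2, ← mul_pow]
      exact pow_le_pow_left₀ (by positivity) h1 2
    have h3 : Real.exp (9 * η) * (R * Real.exp (-(5 * cfEtaBar N))) ^ 2 ≤ R ^ 2 := by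
      have e1 : (R * Real.exp (-(5 * cfEtaBar N))) ^ 2 = R ^ 2 * Real.exp (-(10 * cfEtaBar N)) := by
        rw [mul_pow, ← Real.exp_nat_mul]; congr 1; congr 1; push_cast; ring
      have e2 : Real.exp (9 * η) * Real.exp (-(10 * cfEtaBar N)) ≤ 1 := by
        rw [← Real.exp_add, Real.exp_le_one_iff]; nlinarith
      rw [e1]
      calc Real.exp (9 * η) * (R ^ 2 * Real.exp (-(10 * cfEtaBar N)))
          = R ^ 2 * (Real.exp (9 * η) * Real.exp (-(10 * cfEtaBar N))) := by ring
        _ ≤ R ^ 2 * 1 := mul_le_mul_of_nonneg_left e2 (sq_nonneg R)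
        _ = R ^ 2 := mul_one _
    calc _ ≤ Real.exp (9 * η) * ((d * cfΘ₀.Φ y) ^ 2 * C) := hup
      _ ≤ Real.exp (9 * η) * (R * Real.exp (-(5 * cfEtaBar N))) ^ 2 :=
          mul_le_mul_of_nonneg_left h2 (Real.exp_pos _).le
      _ ≤ R ^ 2 := h3
  · intro h
    -- `e^{-16η} (dΦ)² C ≤ R²` ⇒ `(dΦ √C)² ≤ (R e^{8η̄})²`
    have h1 : (d * cfΘ₀.Φ y * Real.sqrt C) ^ 2 ≤ (R * Real.exp (8 * cfEtaBar N)) ^ 2 := by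
      have e1 : (R * Real.exp (8 * cfEtaBar N)) ^ 2 = R ^ 2 * Real.exp (16 * cfEtaBar N) := by
        rw [mul_pow, ← Real.exp_nat_mul]; congr 1; congr 1; push_cast; ring
      have h2 : (d * cfΘ₀.Φ y) ^ 2 * C ≤ Real.exp (16 * η) * R ^ 2 := by
        have h' := hlo.trans h
        rw [Real.exp_neg] at h'
        rwa [inv_mul_le_iff₀ (Real.exp_pos _)] at h'
      have h3 : Real.exp (16 * η) ≤ Real.exp (16 * cfEtaBar N) := Real.exp_le_exp.2 (by nlinarith)
      rw [mul_pow, hsC2, e1]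
      calc (d * cfΘ₀.Φ y) ^ 2 * C ≤ Real.exp (16 * η) * R ^ 2 := h2
        _ ≤ Real.exp (16 * cfEtaBar N) * R ^ 2 := mul_le_mul_of_nonneg_right h3 (sq_nonneg R)
        _ = R ^ 2 * Real.exp (16 * cfEtaBar N) := mul_comm _ _
    have h4 : d * cfΘ₀.Φ y * Real.sqrt C ≤ R * Real.exp (8 * cfEtaBar N) :=
      (pow_le_pow_iff_left₀ (by positivity) (by positivity) two_ne_zero).1 h1
    rw [le_div_iff₀ hsC]
    exact h4

end Sandwich

/-! ### The norm counts by word length and by suffix -/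

variable (A) in
/-- `N_n^{norm}(R) = #{w ∈ Aⁿ : ‖M_w‖² ≤ R²}` for `n` even and nonzero, `0` otherwise. [folklore] -/
def cfLenNormCount (n : ℕ) (R : ℝ) : ℝ :=
  if Even n ∧ n ≠ 0 then ∑ w : Fin n → A, (if cfNormSq (cfMat fun i => ((w i : A) : ℕ)) ≤ R ^ 2 then (1 : ℝ) else 0)
  else 0

variable (A) in
/-- **The per-suffix count** `S_v(R) = Σ_m #{u ∈ A^{2m} : ‖M_u M_v‖² ≤ R²}`. [cite: MageeOhWinter2019, §3] -/
def cfSuffixCount {N : ℕ} (v : Fin N → A) (R : ℝ) : ℝ :=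
  ∑' m, ∑ u : Fin (2 * m) → A,
    (if cfNormSq (cfMat (fun i => ((u i : A) : ℕ)) * cfMat (fun i => ((v i : A) : ℕ))) ≤ R ^ 2 then (1 : ℝ) else 0)

/-- `N_n^{norm} ≥ 0`. [folklore] -/
theorem cfLenNormCount_nonneg (n : ℕ) (R : ℝ) : 0 ≤ cfLenNormCount A n R := by
  unfold cfLenNormCount
  split_ifs
  · exact Finset.sum_nonneg fun _ _ => by split_ifs <;> norm_num
  · exact le_rfl

/-- `N_n^{norm}(R) = 0` for `2^K > R²`, `n > K`. [folklore] -/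
theorem cfLenNormCount_eq_zero (hA : ∀ a ∈ A, 1 ≤ a) {K : ℕ} {R : ℝ} (hK : R ^ 2 < (2 : ℝ) ^ K) {n : ℕ}
    (hn : K < n) : cfLenNormCount A n R = 0 := by
  unfold cfLenNormCount
  split_ifs
  · refine Finset.sum_eq_zero fun w _ => if_neg fun hw => ?_
    have := length_le_of_cfNormSq_le hA w hK hw
    omega
  · rfl

/-- The length series has finite support. [folklore] -/
theorem summable_cfLenNormCount (hA : ∀ a ∈ A, 1 ≤ a) (R : ℝ) : Summable fun n => cfLenNormCount A n R := by
  obtain ⟨K, hK⟩ := exists_pow_two_gt R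
  refine summable_of_ne_finset_zero (s := Finset.range (K + 1)) fun n hn => ?_
  rw [Finset.mem_range, not_lt] at hn
  exact cfLenNormCount_eq_zero hA hK (by omega)

/-- The suffix summand vanishes for long prefixes: if `2^K > R²` and `2m + N > K`. [folklore] -/
theorem suffix_summand_eq_zero (hA : ∀ a ∈ A, 1 ≤ a) {N : ℕ} (v : Fin N → A) {K : ℕ} {R : ℝ}
    (hK : R ^ 2 < (2 : ℝ) ^ K) {m : ℕ} (hm : K < 2 * m + N) :
    ∑ u : Fin (2 * m) → A,
      (if cfNormSq (cfMat (fun i => ((u i : A) : ℕ)) * cfMat (fun i => ((v i : A) : ℕ))) ≤ R ^ 2 then (1 : ℝ) else 0) = 0 := by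
  refine Finset.sum_eq_zero fun u _ => if_neg fun hu => ?_
  rw [← cfNormSq_cfMat_append] at hu
  have := length_le_of_cfNormSq_le hA (Fin.append u v) hK hu
  omega

/-- The suffix series has finite support. [folklore] -/
theorem summable_suffix (hA : ∀ a ∈ A, 1 ≤ a) {N : ℕ} (v : Fin N → A) (R : ℝ) :
    Summable fun m => ∑ u : Fin (2 * m) → A,
      (if cfNormSq (cfMat (fun i => ((u i : A) : ℕ)) * cfMat (fun i => ((v i : A) : ℕ))) ≤ R ^ 2 then (1 : ℝ) else 0) := by
  obtain ⟨K, hK⟩ := exists_pow_two_gt R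
  refine summable_of_ne_finset_zero (s := Finset.range (K + 1)) fun m hm => ?_
  rw [Finset.mem_range, not_lt] at hm
  exact suffix_summand_eq_zero hA v hK (by omega)

/-! ### `cfCount A 1 1 R` as a sum over even words -/

/-- The matrix of the element attached to an even word is its word matrix. [folklore] -/
theorem coe_cfToElement (hne : A.Nonempty) (x : cfEvenWords A) :
    (((cfToElement hne x).1 : SL(2, ℤ)) : Matrix (Fin 2) (Fin 2) ℤ) = cfMat fun i => ((x.1.2 i : A) : ℕ) := by
  show cfWord (cfFill hne x.1.2) x.1.1 = _
  rw [cfWord_cfFill]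

/-- **`cfCount A 1 1 R = Σ_n N_n^{norm}(R)`** (words ↔ elements of `Γ_A`, `cfToElement_bijective`).
[cite: MageeOhWinter2019, §2.1 II] -/
theorem cfCount_eq_tsum (hA : ∀ a ∈ A, 1 ≤ a) (hne : A.Nonempty) (R : ℝ) :
    (cfCount A 1 1 R : ℝ) = ∑' n, cfLenNormCount A n R := by
  classical
  obtain ⟨K, hK⟩ := exists_pow_two_gt R
  -- the finite set of even words in the ball
  set S : Finset (Σ n : ℕ, Fin n → A) :=
    ((Finset.range (K + 1)).sigma fun n => (Finset.univ : Finset (Fin n → A))).filter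
      (fun x => Even x.1 ∧ x.1 ≠ 0 ∧ cfNormSq (cfMat fun i => ((x.2 i : A) : ℕ)) ≤ R ^ 2) with hS
  -- the word-to-element map
  set f : (Σ n : ℕ, Fin n → A) → SL(2, ℤ) := fun x =>
    if h : Even x.1 ∧ x.1 ≠ 0 then ((cfToElement hne ⟨x, h⟩).1 : SL(2, ℤ)) else 1 with hf
  have hfS : ∀ x ∈ S, ∃ h : Even x.1 ∧ x.1 ≠ 0, f x = (cfToElement hne ⟨x, h⟩).1 ∧
      cfNormSq (cfMat fun i => ((x.2 i : A) : ℕ)) ≤ R ^ 2 := by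
    intro x hx
    rw [hS, Finset.mem_filter] at hx
    exact ⟨⟨hx.2.1, hx.2.2.1⟩, by simp only [hf, dif_pos (And.intro hx.2.1 hx.2.2.1)], hx.2.2.2⟩
  have himage : cfBall A R = f '' ↑S := by
    ext γ
    constructor
    · rintro ⟨hγ, hnorm, -⟩
      obtain ⟨x, hx⟩ := (cfToElement_bijective hA hne).2 ⟨γ, hγ⟩
      have hmat : (γ : Matrix (Fin 2) (Fin 2) ℤ) = cfMat fun i => ((x.1.2 i : A) : ℕ) := by
        rw [← coe_cfToElement hne x, hx]
      have hnorm' : cfNormSq (cfMat fun i => ((x.1.2 i : A) : ℕ)) ≤ R ^ 2 := by rw [← hmat]; exact hnorm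
      refine ⟨x.1, ?_, ?_⟩
      · rw [Finset.mem_coe, hS, Finset.mem_filter, Finset.mem_sigma, Finset.mem_range]
        exact ⟨⟨Nat.lt_succ_of_le (length_le_of_cfNormSq_le hA x.1.2 hK hnorm'), Finset.mem_univ _⟩,
          x.2.1, x.2.2, hnorm'⟩
      · simp only [hf, dif_pos x.2]
        rw [hx]
    · rintro ⟨x, hx, rfl⟩
      obtain ⟨h, hfx, hnorm⟩ := hfS x hx
      rw [hfx]
      refine ⟨(cfToElement hne ⟨x, h⟩).2, ?_, map_zmod_one_eq_one _⟩
      rw [coe_cfToElement hne ⟨x, h⟩]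
      exact hnorm
  have hinj : Set.InjOn f ↑S := by
    intro x hx y hy hxy
    obtain ⟨hx', hfx, -⟩ := hfS x hx
    obtain ⟨hy', hfy, -⟩ := hfS y hy
    rw [hfx, hfy] at hxy
    have h := (cfToElement_bijective hA hne).1 (Subtype.ext hxy)
    exact congrArg Subtype.val h
  have hcard : cfCount A 1 1 R = S.card := by
    rw [cfCount_one_eq, himage, hinj.ncard_image, Set.ncard_coe_finset]
  -- the cardinality as a sum
  have hsum : (S.card : ℝ) = ∑ n ∈ Finset.range (K + 1), cfLenNormCount A n R := by
    rw [hS, Finset.card_filter, Nat.cast_sum, Finset.sum_sigma]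
    refine Finset.sum_congr rfl fun n _ => ?_
    rw [cfLenNormCount]
    by_cases hpar : Even n ∧ n ≠ 0
    · rw [if_pos hpar]
      refine Finset.sum_congr rfl fun w _ => ?_
      by_cases hw : cfNormSq (cfMat fun i => ((w i : A) : ℕ)) ≤ R ^ 2
      · have hc : Even n ∧ n ≠ 0 ∧ cfNormSq (cfMat fun i => ((w i : A) : ℕ)) ≤ R ^ 2 := ⟨hpar.1, hpar.2, hw⟩
        simp [hc]
      · have hc : ¬(Even n ∧ n ≠ 0 ∧ cfNormSq (cfMat fun i => ((w i : A) : ℕ)) ≤ R ^ 2) := fun h => hw h.2.2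
        simp [hw]
    · rw [if_neg hpar]
      refine Finset.sum_eq_zero fun w _ => ?_
      have hc : ¬(Even n ∧ n ≠ 0 ∧ cfNormSq (cfMat fun i => ((w i : A) : ℕ)) ≤ R ^ 2) := fun h => hpar ⟨h.1, h.2.1⟩
      simp [hc]
  rw [hcard, hsum, tsum_eq_sum]
  intro n hn
  rw [Finset.mem_range, not_lt] at hn
  exact cfLenNormCount_eq_zero hA hK (by omega)

/-! ### The suffix decomposition -/

/-- **Suffix decomposition of the norm count:** for `N` even and nonzero,
`Σ_n N_n^{norm}(R) = Σ_{n < N} N_n^{norm}(R) + Σ_{|v| = N} S_v(R)`. [cite: MageeOhWinter2019, Lemma 14] -/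
theorem tsum_cfLenNormCount_split (hA : ∀ a ∈ A, 1 ≤ a) {N : ℕ} (hN : Even N) (hN0 : N ≠ 0) (R : ℝ) :
    ∑' n, cfLenNormCount A n R =
      ∑ n ∈ Finset.range N, cfLenNormCount A n R + ∑ v : Fin N → A, cfSuffixCount A v R := by
  have hsum := summable_cfLenNormCount hA R
  have h1 : ∑' n, cfLenNormCount A n R =
      ∑ n ∈ Finset.range N, cfLenNormCount A n R + ∑' n, cfLenNormCount A (n + N) R :=
    (hsum.sum_add_tsum_nat_add N).symm
  -- odd shifts vanish, even shifts decompose by suffix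
  have hodd : ∀ m, cfLenNormCount A (2 * m + 1 + N) R = 0 := fun m => by
    unfold cfLenNormCount
    rw [if_neg]
    rintro ⟨he, -⟩
    obtain ⟨k, hk⟩ := hN
    rw [Nat.even_iff] at he
    omega
  have heven : ∀ m, cfLenNormCount A (2 * m + N) R = ∑ v : Fin N → A, ∑ u : Fin (2 * m) → A,
      (if cfNormSq (cfMat (fun i => ((u i : A) : ℕ)) * cfMat (fun i => ((v i : A) : ℕ))) ≤ R ^ 2 then (1 : ℝ) else 0) := by
    intro m
    unfold cfLenNormCount
    have hpar : Even (2 * m + N) ∧ 2 * m + N ≠ 0 := ⟨(even_two_mul m).add hN, by omega⟩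
    rw [if_pos hpar, ← (Fin.appendEquiv (2 * m) N).sum_comp, Fintype.sum_prod_type, Finset.sum_comm]
    refine Finset.sum_congr rfl fun v _ => Finset.sum_congr rfl fun u _ => ?_
    show (if cfNormSq (cfMat fun i => ((Fin.append u v i : A) : ℕ)) ≤ R ^ 2 then (1 : ℝ) else 0) = _
    rw [cfNormSq_cfMat_append]
  have hi : Function.Injective (fun m : ℕ => 2 * m + N) := fun a b h => by
    dsimp only at h
    omega
  have hE : Summable fun m => cfLenNormCount A (2 * m + N) R := hsum.comp_injective hi
  have hO : Summable fun m : ℕ => cfLenNormCount A (2 * m + 1 + N) R :=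
    (summable_zero (α := ℝ) (β := ℕ)).congr fun m => (hodd m).symm
  have h2 : ∑' n, cfLenNormCount A (n + N) R = ∑ v : Fin N → A, cfSuffixCount A v R := by
    rw [← tsum_even_add_odd (f := fun n => cfLenNormCount A (n + N) R) hE hO, tsum_congr hodd, tsum_zero, add_zero,
      tsum_congr heven]
    unfold cfSuffixCount
    exact Summable.tsum_finsetSum fun v _ => summable_suffix hA v R
  rw [h1, h2]

/-! ### The sandwich for the suffix counts -/

/-- `N_n(X, x; 𝟙, Φ) = #{u ∈ Aⁿ : d_u(x) Φ(M_u x) ≤ X}`. [folklore] -/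
theorem cfLenCountT_const_one (Θ : CfThreshold) (n : ℕ) (X x : ℝ) :
    cfLenCountT A Θ (CfLip.const 1) n X x =
      ∑ u : Fin n → A, (if cfDenom (cfMat fun i => ((u i : A) : ℕ)) x * Θ.Φ (cfMoeb (cfMat fun i => ((u i : A) : ℕ)) x) ≤ X
        then (1 : ℝ) else 0) := by
  refine Finset.sum_congr rfl fun u _ => ?_
  rw [show (CfLip.const 1).extend (cfMoeb (cfMat fun i => ((u i : A) : ℕ)) x) = 1 from rfl, Complex.one_re, one_mul]

/-- The threshold count for even lengths is summable (finite support). [folklore] -/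
theorem summable_cfLenCountT_even (hA : ∀ a ∈ A, 1 ≤ a) (Θ : CfThreshold) (G : CfLip) {x : ℝ} (hx : x ∈ Icc (0 : ℝ) 1)
    (X : ℝ) : Summable fun m => cfLenCountT A Θ G (2 * m) X x := by
  obtain ⟨K, hK⟩ := exists_pow_two_gt X
  refine summable_of_ne_finset_zero (s := Finset.range (K + 1)) fun m hm => ?_
  rw [Finset.mem_range, not_lt] at hm
  exact cfLenCountT_eq_zero Θ hA G hx hK (by omega)

/-- **The sandwich of the suffix count by the even threshold counts** (for `η̄_N ≤ 1/16`, `R ≥ 0`):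
`N_even(R e^{-5η̄}/√C_v, x_v; 𝟙, Φ) ≤ S_v(R) ≤ N_even(R e^{8η̄}/√C_v, x_v; 𝟙, Φ)`.
[cite: MageeOhWinter2019, Lemma 14] -/
theorem cfSuffixCount_sandwich (hA : ∀ a ∈ A, 1 ≤ a) {N : ℕ} (hN : cfEtaBar N ≤ 1 / 16) (v : Fin N → A) {R : ℝ}
    (hR : 0 ≤ R) :
    let Mv := cfMat fun i => ((v i : A) : ℕ)
    let x := cfMoeb Mv 0
    let C := ‖cfDenC Mv Complex.I‖ ^ 2
    cfEvenCountT A cfΘ₀ (CfLip.const 1) (R * Real.exp (-(5 * cfEtaBar N)) / Real.sqrt C) x ≤ cfSuffixCount A v R ∧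
      cfSuffixCount A v R ≤ cfEvenCountT A cfΘ₀ (CfLip.const 1) (R * Real.exp (8 * cfEtaBar N) / Real.sqrt C) x := by
  intro Mv x C
  have hx : x ∈ Icc (0 : ℝ) 1 := cfMoeb_cfMat_mem (one_le_coe_digit hA v) ⟨le_rfl, zero_le_one⟩
  have hS := summable_suffix hA v R
  constructor
  · refine Summable.tsum_le_tsum (fun m => ?_) (summable_cfLenCountT_even hA cfΘ₀ _ hx _) hS
    rw [cfLenCountT_const_one]
    refine Finset.sum_le_sum fun u _ => ?_
    by_cases h : cfDenom (cfMat fun i => ((u i : A) : ℕ)) x * cfΘ₀.Φ (cfMoeb (cfMat fun i => ((u i : A) : ℕ)) x) ≤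
        R * Real.exp (-(5 * cfEtaBar N)) / Real.sqrt C
    · rw [if_pos h, if_pos ((threshold_sandwich hA hN u v hR).1 h)]
    · rw [if_neg h]; split_ifs <;> norm_num
  · refine Summable.tsum_le_tsum (fun m => ?_) hS (summable_cfLenCountT_even hA cfΘ₀ _ hx _)
    rw [cfLenCountT_const_one]
    refine Finset.sum_le_sum fun u _ => ?_
    by_cases h : cfNormSq (cfMat (fun i => ((u i : A) : ℕ)) * Mv) ≤ R ^ 2
    · rw [if_pos h, if_pos ((threshold_sandwich hA hN u v hR).2 h)]
    · rw [if_neg h]; split_ifs <;> norm_num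

/-- The short words contribute a bounded amount: `Σ_{n<N} N_n^{norm}(R) ≤ Σ_{n<N} |A|ⁿ`. [folklore] -/
theorem sum_cfLenNormCount_le (N : ℕ) (R : ℝ) :
    ∑ n ∈ Finset.range N, cfLenNormCount A n R ≤ ∑ n ∈ Finset.range N, ((Fintype.card (Fin n → A) : ℕ) : ℝ) := by
  refine Finset.sum_le_sum fun n _ => ?_
  unfold cfLenNormCount
  split_ifs
  · calc ∑ w : Fin n → A, (if cfNormSq (cfMat fun i => ((w i : A) : ℕ)) ≤ R ^ 2 then (1 : ℝ) else 0)
        ≤ ∑ _w : Fin n → A, (1 : ℝ) := Finset.sum_le_sum fun w _ => by split_ifs <;> norm_num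
      _ = ((Fintype.card (Fin n → A) : ℕ) : ℝ) := by simp
  · positivity

/-! ### The suffix data and the per-suffix asymptotics -/

section Limit

variable (A) (hA : ∀ a ∈ A, 1 ≤ a) (h2 : 2 ≤ A.card)
include hA h2

/-- The boundary point `x_v = M_v 0 ∈ [0,1]` of a suffix. [folklore] -/
def cfXvI {N : ℕ} (v : Fin N → A) : Icc (0 : ℝ) 1 :=
  ⟨cfMoeb (cfMat fun i => ((v i : A) : ℕ)) 0, cfMoeb_cfMat_mem (one_le_coe_digit hA v) ⟨le_rfl, zero_le_one⟩⟩

omit h2 in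
/-- `√C_v > 0`. [folklore] -/
theorem sqrt_Cv_pos {N : ℕ} (v : Fin N → A) : 0 < Real.sqrt (‖cfDenC (cfMat fun i => ((v i : A) : ℕ)) Complex.I‖ ^ 2) :=
  Real.sqrt_pos.2 (lt_of_lt_of_le one_pos (one_le_normSq_cfDenC hA v))

omit hA h2 in
/-- Rescaling a counting asymptotic: if `E(X) X^{-p} → c` then `E(aX) X^{-p} → a^p c` (`a > 0`). [folklore] -/
theorem tendsto_rescale {E : ℝ → ℝ} {c a : ℝ} (p : ℝ) (ha : 0 < a)
    (h : Tendsto (fun X : ℝ => E X / X ^ p) atTop (𝓝 c)) :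
    Tendsto (fun R : ℝ => E (a * R) / R ^ p) atTop (𝓝 (a ^ p * c)) := by
  have h1 := (h.comp (tendsto_id.const_mul_atTop ha)).const_mul (a ^ p)
  refine h1.congr' ?_
  filter_upwards [eventually_gt_atTop 0] with R hR
  have hap : 0 < a ^ p := Real.rpow_pos_of_pos ha p
  show a ^ p * (E (a * id R) / (a * id R) ^ p) = E (a * R) / R ^ p
  rw [id, Real.mul_rpow ha.le hR.le]
  field_simp

/-- **Per-suffix asymptotics:** `N_even(a R, x_v; 𝟙, Φ) R^{-2δ} → a^{2δ} c_v` with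
`c_v = ½ ν(Φ^{-2δ}) h(x_v)/(δ κ)`. [cite: MageeOhWinter2019, Prop. 17] -/
theorem tendsto_suffix_even {N : ℕ} (v : Fin N → A) {a : ℝ} (ha : 0 < a) :
    Tendsto (fun R : ℝ => cfEvenCountT A cfΘ₀ (CfLip.const 1) (a * R) (cfXvI A hA v) / R ^ (2 * cfDimension A)) atTop
      (𝓝 (a ^ (2 * cfDimension A) * cfEvenConst A hA h2 cfΘ₀ (CfLip.const 1) (cfXvI A hA v))) :=
  tendsto_rescale _ ha (cfEvenCountT_asymp A hA h2 cfΘ₀ const_one_real_nonneg.1 const_one_real_nonneg.2 (cfXvI A hA v))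

/-- The lower comparison function `h_N(R) = Σ_v N_even(a₋(v) R, x_v) R^{-2δ}` and its limit. [folklore] -/
theorem tendsto_lower (N : ℕ) :
    Tendsto (fun R : ℝ => (∑ v : Fin N → A, cfEvenCountT A cfΘ₀ (CfLip.const 1)
        (Real.exp (-(5 * cfEtaBar N)) / Real.sqrt (‖cfDenC (cfMat fun i => ((v i : A) : ℕ)) Complex.I‖ ^ 2) * R) (cfXvI A hA v)) /
        R ^ (2 * cfDimension A)) atTop
      (𝓝 (∑ v : Fin N → A, (Real.exp (-(5 * cfEtaBar N)) / Real.sqrt (‖cfDenC (cfMat fun i => ((v i : A) : ℕ)) Complex.I‖ ^ 2)) ^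
          (2 * cfDimension A) * cfEvenConst A hA h2 cfΘ₀ (CfLip.const 1) (cfXvI A hA v))) := by
  simp_rw [Finset.sum_div]
  exact tendsto_finsetSum _ fun v _ => tendsto_suffix_even A hA h2 v (div_pos (Real.exp_pos _) (sqrt_Cv_pos A hA v))

/-- The upper comparison function `g_N(R) = (b_N + Σ_v N_even(a₊(v) R, x_v)) R^{-2δ}` and its limit. [folklore] -/
theorem tendsto_upper (N : ℕ) (b : ℝ) :
    Tendsto (fun R : ℝ => (b + ∑ v : Fin N → A, cfEvenCountT A cfΘ₀ (CfLip.const 1)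
        (Real.exp (8 * cfEtaBar N) / Real.sqrt (‖cfDenC (cfMat fun i => ((v i : A) : ℕ)) Complex.I‖ ^ 2) * R) (cfXvI A hA v)) /
        R ^ (2 * cfDimension A)) atTop
      (𝓝 (∑ v : Fin N → A, (Real.exp (8 * cfEtaBar N) / Real.sqrt (‖cfDenC (cfMat fun i => ((v i : A) : ℕ)) Complex.I‖ ^ 2)) ^
          (2 * cfDimension A) * cfEvenConst A hA h2 cfΘ₀ (CfLip.const 1) (cfXvI A hA v))) := by
  have hδ : 0 < 2 * cfDimension A := by linarith [cfDimension_pos hA h2]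
  simp_rw [add_div, Finset.sum_div]
  have h0 : Tendsto (fun R : ℝ => b / R ^ (2 * cfDimension A)) atTop (𝓝 0) :=
    tendsto_const_nhds.div_atTop (tendsto_rpow_atTop hδ)
  have h1 := tendsto_finsetSum (Finset.univ : Finset (Fin N → A)) fun v _ =>
    tendsto_suffix_even A hA h2 v (div_pos (Real.exp_pos (8 * cfEtaBar N)) (sqrt_Cv_pos A hA v))
  simpa using h0.add h1

/-- The two limits differ by the factor `e^{26 δ η̄_N}`: `a₊(v) = e^{13η̄} a₋(v)`. [folklore] -/
theorem upper_eq_exp_mul_lower (N : ℕ) :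
    (∑ v : Fin N → A, (Real.exp (8 * cfEtaBar N) / Real.sqrt (‖cfDenC (cfMat fun i => ((v i : A) : ℕ)) Complex.I‖ ^ 2)) ^
        (2 * cfDimension A) * cfEvenConst A hA h2 cfΘ₀ (CfLip.const 1) (cfXvI A hA v)) =
      Real.exp (13 * cfEtaBar N * (2 * cfDimension A)) *
        ∑ v : Fin N → A, (Real.exp (-(5 * cfEtaBar N)) / Real.sqrt (‖cfDenC (cfMat fun i => ((v i : A) : ℕ)) Complex.I‖ ^ 2)) ^
          (2 * cfDimension A) * cfEvenConst A hA h2 cfΘ₀ (CfLip.const 1) (cfXvI A hA v) := by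
  rw [Finset.mul_sum]
  refine Finset.sum_congr rfl fun v _ => ?_
  have hs := sqrt_Cv_pos A hA v
  have hfac : Real.exp (8 * cfEtaBar N) / Real.sqrt (‖cfDenC (cfMat fun i => ((v i : A) : ℕ)) Complex.I‖ ^ 2) =
      Real.exp (13 * cfEtaBar N) *
        (Real.exp (-(5 * cfEtaBar N)) / Real.sqrt (‖cfDenC (cfMat fun i => ((v i : A) : ℕ)) Complex.I‖ ^ 2)) := by
    rw [← mul_div_assoc, ← Real.exp_add]
    congr 1; congr 1; ring
  rw [hfac, Real.mul_rpow (Real.exp_pos _).le (div_pos (Real.exp_pos _) hs).le, ← Real.exp_mul, mul_assoc]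

/-! ### The main theorem -/

/-- **The Frobenius-norm orbit count for `Γ_A`** ([MageeOhWinter2019, Thm. 11] with `q = 1`,
`G ≡ 1`, `γ₀ = e`, main term; Hensley, Lalley): there is `c_A > 0` with
`#{γ ∈ Γ_A : ‖γ‖_F ≤ R} = cfCount A 1 1 R ~ c_A R^{2δ_A}` as `R → ∞`. [cite: MageeOhWinter2019, Thm. 11] -/
theorem cfCount_one_tendsto :
    ∃ c : ℝ, 0 < c ∧ Tendsto (fun R : ℝ => (cfCount A 1 1 R : ℝ) / R ^ (2 * cfDimension A)) atTop (𝓝 c) := by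
  have hδ := cfDimension_pos hA h2
  have hne : A.Nonempty := nonempty_of_two_le_card h2
  set p : ℝ := 2 * cfDimension A with hp
  set f : ℝ → ℝ := fun R => (cfCount A 1 1 R : ℝ) / R ^ p with hfdef
  -- a priori bounds: `c₁ ≤ f ≤ c₂` eventually
  obtain ⟨c₂, hc₂, hup⟩ := cfCount_one_le hA h2
  obtain ⟨R₀, hR₀, c₁, hc₁, hlow⟩ := le_cfCount_one hA h2
  have hf_le : ∀ᶠ R in atTop, f R ≤ c₂ := by
    filter_upwards [eventually_ge_atTop 1] with R hR
    have hRp : 0 < R ^ p := Real.rpow_pos_of_pos (by linarith) p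
    exact (div_le_iff₀ hRp).2 (hup R hR)
  have hf_ge : ∀ᶠ R in atTop, c₁ ≤ f R := by
    filter_upwards [eventually_ge_atTop (max R₀ 1)] with R hR
    have hRp : 0 < R ^ p := Real.rpow_pos_of_pos (by linarith [le_max_right R₀ 1]) p
    exact (le_div_iff₀ hRp).2 (hlow R ((le_max_left _ _).trans hR))
  have hbdd_le : IsBoundedUnder (· ≤ ·) atTop f := isBoundedUnder_of_eventually_le hf_le
  have hbdd_ge : IsBoundedUnder (· ≥ ·) atTop f := isBoundedUnder_of_eventually_ge hf_ge
  have hco_le : IsCoboundedUnder (· ≤ ·) atTop f := hbdd_ge.isCoboundedUnder_le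
  have hco_ge : IsCoboundedUnder (· ≥ ·) atTop f := hbdd_le.isCoboundedUnder_ge
  -- the sandwich for a fixed even suffix length `N` with `η̄_N ≤ 1/16`
  have key : ∀ N : ℕ, Even N → N ≠ 0 → cfEtaBar N ≤ 1 / 16 →
      limsup f atTop ≤ Real.exp (13 * cfEtaBar N * p) * liminf f atTop := by
    intro N hNev hN0 hη
    -- notation for the two limits
    set L : ℝ := ∑ v : Fin N → A, (Real.exp (-(5 * cfEtaBar N)) /
      Real.sqrt (‖cfDenC (cfMat fun i => ((v i : A) : ℕ)) Complex.I‖ ^ 2)) ^ p *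
        cfEvenConst A hA h2 cfΘ₀ (CfLip.const 1) (cfXvI A hA v) with hL
    set U : ℝ := ∑ v : Fin N → A, (Real.exp (8 * cfEtaBar N) /
      Real.sqrt (‖cfDenC (cfMat fun i => ((v i : A) : ℕ)) Complex.I‖ ^ 2)) ^ p *
        cfEvenConst A hA h2 cfΘ₀ (CfLip.const 1) (cfXvI A hA v) with hU
    set b : ℝ := ∑ n ∈ Finset.range N, ((Fintype.card (Fin n → A) : ℕ) : ℝ) with hb
    set gU : ℝ → ℝ := fun R => (b + ∑ v : Fin N → A, cfEvenCountT A cfΘ₀ (CfLip.const 1)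
        (Real.exp (8 * cfEtaBar N) / Real.sqrt (‖cfDenC (cfMat fun i => ((v i : A) : ℕ)) Complex.I‖ ^ 2) * R) (cfXvI A hA v)) /
        R ^ p with hgU
    set gL : ℝ → ℝ := fun R => (∑ v : Fin N → A, cfEvenCountT A cfΘ₀ (CfLip.const 1)
        (Real.exp (-(5 * cfEtaBar N)) / Real.sqrt (‖cfDenC (cfMat fun i => ((v i : A) : ℕ)) Complex.I‖ ^ 2) * R) (cfXvI A hA v)) /
        R ^ p with hgL
    have htU : Tendsto gU atTop (𝓝 U) := tendsto_upper A hA h2 N b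
    have htL : Tendsto gL atTop (𝓝 L) := tendsto_lower A hA h2 N
    -- pointwise comparison for `R > 0`
    have hcmp : ∀ R : ℝ, 0 < R → gL R ≤ f R ∧ f R ≤ gU R := by
      intro R hR
      have hRp : 0 < R ^ p := Real.rpow_pos_of_pos hR p
      have hdec := tsum_cfLenNormCount_split hA hNev hN0 R
      have hcount : (cfCount A 1 1 R : ℝ) = ∑ n ∈ Finset.range N, cfLenNormCount A n R + ∑ v : Fin N → A, cfSuffixCount A v R := by
        rw [cfCount_eq_tsum hA hne R, hdec]
      have hsand := fun v : Fin N → A => cfSuffixCount_sandwich hA hη v hR.le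
      constructor
      · simp only [hfdef]
        refine div_le_div_of_nonneg_right ?_ hRp.le
        rw [hcount]
        have h0 : 0 ≤ ∑ n ∈ Finset.range N, cfLenNormCount A n R := Finset.sum_nonneg fun n _ => cfLenNormCount_nonneg n R
        have h1 : ∑ v : Fin N → A, cfEvenCountT A cfΘ₀ (CfLip.const 1)
            (Real.exp (-(5 * cfEtaBar N)) / Real.sqrt (‖cfDenC (cfMat fun i => ((v i : A) : ℕ)) Complex.I‖ ^ 2) * R) (cfXvI A hA v) ≤
            ∑ v : Fin N → A, cfSuffixCount A v R := by
          refine Finset.sum_le_sum fun v _ => ?_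
          have h := (hsand v).1
          rwa [show R * Real.exp (-(5 * cfEtaBar N)) / Real.sqrt (‖cfDenC (cfMat fun i => ((v i : A) : ℕ)) Complex.I‖ ^ 2) =
            Real.exp (-(5 * cfEtaBar N)) / Real.sqrt (‖cfDenC (cfMat fun i => ((v i : A) : ℕ)) Complex.I‖ ^ 2) * R by ring] at h
        linarith
      · simp only [hfdef]
        refine div_le_div_of_nonneg_right ?_ hRp.le
        rw [hcount]
        have h0 := sum_cfLenNormCount_le (A := A) N R
        have h1 : ∑ v : Fin N → A, cfSuffixCount A v R ≤ ∑ v : Fin N → A, cfEvenCountT A cfΘ₀ (CfLip.const 1)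
            (Real.exp (8 * cfEtaBar N) / Real.sqrt (‖cfDenC (cfMat fun i => ((v i : A) : ℕ)) Complex.I‖ ^ 2) * R) (cfXvI A hA v) := by
          refine Finset.sum_le_sum fun v _ => ?_
          have h := (hsand v).2
          rwa [show R * Real.exp (8 * cfEtaBar N) / Real.sqrt (‖cfDenC (cfMat fun i => ((v i : A) : ℕ)) Complex.I‖ ^ 2) =
            Real.exp (8 * cfEtaBar N) / Real.sqrt (‖cfDenC (cfMat fun i => ((v i : A) : ℕ)) Complex.I‖ ^ 2) * R by ring] at h
        linarith
    have hfU : ∀ᶠ R in atTop, f R ≤ gU R := (eventually_gt_atTop 0).mono fun R hR => (hcmp R hR).2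
    have hfL : ∀ᶠ R in atTop, gL R ≤ f R := (eventually_gt_atTop 0).mono fun R hR => (hcmp R hR).1
    have hsup : limsup f atTop ≤ U := by
      rw [← htU.limsup_eq]
      exact limsup_le_limsup hfU hco_le htU.isBoundedUnder_le
    have hinf : L ≤ liminf f atTop := by
      rw [← htL.liminf_eq]
      exact liminf_le_liminf hfL htL.isBoundedUnder_ge hco_ge
    have hUL : U = Real.exp (13 * cfEtaBar N * p) * L := upper_eq_exp_mul_lower A hA h2 N
    calc limsup f atTop ≤ U := hsup
      _ = Real.exp (13 * cfEtaBar N * p) * L := hUL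
      _ ≤ Real.exp (13 * cfEtaBar N * p) * liminf f atTop := mul_le_mul_of_nonneg_left hinf (Real.exp_pos _).le
  -- let `N = 2k → ∞`
  have hlimfac : Tendsto (fun k : ℕ => Real.exp (13 * cfEtaBar (2 * k) * p) * liminf f atTop) atTop
      (𝓝 (1 * liminf f atTop)) := by
    refine (Tendsto.mul_const _ ?_)
    rw [← Real.exp_zero]
    refine (Real.continuous_exp.tendsto 0).comp ?_
    have hη : Tendsto (fun k : ℕ => cfEtaBar (2 * k)) atTop (𝓝 0) := by
      have hg : Tendsto (fun n : ℕ => (1 / 2 : ℝ) ^ n) atTop (𝓝 0) :=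
        tendsto_pow_atTop_nhds_zero_of_lt_one (by norm_num) (by norm_num)
      have hidx : Tendsto (fun k : ℕ => 2 * k - 1) atTop atTop := by
        refine tendsto_atTop_atTop.2 fun b => ⟨b + 1, fun k hk => by omega⟩
      exact hg.comp hidx
    simpa using (hη.mul_const p).const_mul 13 |>.congr' (Eventually.of_forall fun k => by ring)
  rw [one_mul] at hlimfac
  have hsuple : limsup f atTop ≤ liminf f atTop := by
    refine ge_of_tendsto' hlimfac fun k => ?_
    rcases Nat.lt_or_ge k 3 with hk | hk
    · -- small `k`: use a large even `N` instead (the bound is monotone-free, so pick `N = 6`)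
      have h6 : cfEtaBar 6 ≤ 1 / 16 := by unfold cfEtaBar; norm_num
      have hk6 := key 6 (by decide) (by norm_num) h6
      refine hk6.trans (mul_le_mul_of_nonneg_right (Real.exp_le_exp.2 ?_) ?_)
      · have : cfEtaBar 6 ≤ cfEtaBar (2 * k) := by
          unfold cfEtaBar
          exact pow_le_pow_of_le_one (by norm_num) (by norm_num) (by omega)
        nlinarith [cfEtaBar_nonneg 6]
      · exact le_trans hc₁.le (le_liminf_of_le hco_ge hf_ge)
    · refine key (2 * k) (even_two_mul k) (by omega) ?_
      unfold cfEtaBar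
      calc (1 / 2 : ℝ) ^ (2 * k - 1) ≤ (1 / 2 : ℝ) ^ 5 := pow_le_pow_of_le_one (by norm_num) (by norm_num) (by omega)
        _ ≤ 1 / 16 := by norm_num
  have hinfle : liminf f atTop ≤ limsup f atTop := liminf_le_limsup hbdd_le hbdd_ge
  have heq : liminf f atTop = limsup f atTop := le_antisymm hinfle hsuple
  refine ⟨limsup f atTop, ?_, ?_⟩
  · exact lt_of_lt_of_le hc₁ ((le_liminf_of_le hco_ge hf_ge).trans hinfle)
  · exact tendsto_of_le_liminf_of_limsup_le (by rw [heq]) le_rfl hbdd_le hbdd_ge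

end Limit

end Literature.NumberTheory.Sieve
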